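import Summits.ResolutionOfSingularities.ResolutionOfSingularities.Theorems.SyzygyFlatteningDefs

/-!
# The weight monomial order `(1, √2)` and the monomial valuation on `k[x, y]`

Part 1 of the construction of a NON-discrete rank-one dimension-zero valuation ring (negative
lemma for crux `RankOneTermination`, stmt-ResolutionOfSingularities-17044, route
`SyzygyFlattening`; part 2 = `NonDiscreteMonomialValuation`):

* `wt d = d 0 + d 1 * √2` on exponents `d : Fin 2 →₀ ℕ` is injective (`√2` is irrational),
  additive and monotone; ordering exponents by `wt` is a monomial order `wtOrder` (well founded
  because weight-bounded sets of exponents are finite);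
* `wtValuation k : Valuation (MvPolynomial (Fin 2) k) ℝ≥0`, `f ↦ exp (wt (wtOrder.degree f))`
  — the monomial valuation `x ↦ e, y ↦ e^{√2}` (at infinity);
* `v_sub_smul_lt`: cancellation of leading terms (`a - (lc a / lc b) • b` drops in value when
  `deg a = deg b`), the engine of "residue field `= k`".

[topic AlgebraicGeometry/Valuation] — general-purpose (Zariski–Samuel VI §10, §15).
-/

noncomputable section

-- single-problem summit: the doubled namespace component `ResolutionOfSingularities` is forced
set_option linter.dupNamespace false

open MvPolynomial

namespace Summit.ResolutionOfSingularities.ResolutionOfSingularities.Theorems.RankOneTermination.Negative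

namespace MonomialValuation
/-! ## The weight `d ↦ d 0 + d 1 * √2` on exponents -/

/-- The irrational weight of an exponent vector: `d 0 + d 1 * √2`. -/
def wt (d : Fin 2 →₀ ℕ) : ℝ := (d 0 : ℝ) + (d 1 : ℝ) * Real.sqrt 2

/-- The weight is additive. [folklore] -/
theorem wt_add (d e : Fin 2 →₀ ℕ) : wt (d + e) = wt d + wt e := by
  simp only [wt, Finsupp.coe_add, Pi.add_apply, Nat.cast_add]
  ring

/-- The weight of `0` is `0`. [folklore] -/
@[simp] theorem wt_zero : wt 0 = 0 := by simp [wt]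

/-- Weights are nonnegative. [folklore] -/
theorem wt_nonneg (d : Fin 2 →₀ ℕ) : 0 ≤ wt d := by
  unfold wt; positivity

/-- The first exponent is bounded by the weight. [folklore] -/
theorem le_wt_left (d : Fin 2 →₀ ℕ) : (d 0 : ℝ) ≤ wt d := by
  unfold wt
  have : (0 : ℝ) ≤ (d 1 : ℝ) * Real.sqrt 2 := by positivity
  linarith

/-- The second exponent is bounded by the weight (`1 ≤ √2`). [folklore] -/
theorem le_wt_right (d : Fin 2 →₀ ℕ) : (d 1 : ℝ) ≤ wt d := by
  unfold wt
  have h1 : (1 : ℝ) ≤ Real.sqrt 2 := by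
    rw [show (1 : ℝ) = Real.sqrt 1 by simp]
    exact Real.sqrt_le_sqrt (by norm_num)
  have h0 : (0 : ℝ) ≤ (d 0 : ℝ) := by positivity
  have : (d 1 : ℝ) ≤ (d 1 : ℝ) * Real.sqrt 2 := by
    have := mul_le_mul_of_nonneg_left h1 (show (0 : ℝ) ≤ (d 1 : ℝ) by positivity)
    simpa using this
  linarith

/-- The weight is injective on exponents, because `√2` is irrational. [folklore] -/
theorem wt_injective : Function.Injective wt := by
  intro d e h
  simp only [wt] at h
  -- (d0 - e0) = (e1 - d1) * √2
  have hirr := irrational_sqrt_two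
  have h1 : (d 1 : ℝ) = (e 1 : ℝ) := by
    by_contra hne
    have hne' : ((e 1 : ℝ) - (d 1 : ℝ)) ≠ 0 := fun h0 => hne (by linarith)
    have : Real.sqrt 2 = ((d 0 : ℝ) - (e 0 : ℝ)) / ((e 1 : ℝ) - (d 1 : ℝ)) := by
      field_simp
      linarith
    apply hirr
    refine ⟨((d 0 : ℚ) - (e 0 : ℚ)) / ((e 1 : ℚ) - (d 1 : ℚ)), ?_⟩
    rw [this]
    push_cast
    ring
  have h0 : (d 0 : ℝ) = (e 0 : ℝ) := by
    rw [h1] at h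
    linarith
  have h0' : d 0 = e 0 := by exact_mod_cast h0
  have h1' : d 1 = e 1 := by exact_mod_cast h1
  ext i
  fin_cases i
  · exact h0'
  · exact h1'

/-- The weight is monotone for the product order. [folklore] -/
theorem wt_mono {d e : Fin 2 →₀ ℕ} (h : d ≤ e) : wt d ≤ wt e := by
  unfold wt
  have h0 : (d 0 : ℝ) ≤ (e 0 : ℝ) := by exact_mod_cast h 0
  have h1 : (d 1 : ℝ) ≤ (e 1 : ℝ) := by exact_mod_cast h 1
  have hs : (0 : ℝ) ≤ Real.sqrt 2 := Real.sqrt_nonneg _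
  nlinarith

/-- Exponents of weight below a bound form a finite set. -/
theorem finite_wt_lt (C : ℝ) : {d : Fin 2 →₀ ℕ | wt d < C}.Finite := by
  classical
  obtain ⟨N, hN⟩ := exists_nat_gt C
  refine (Set.Finite.image (fun ab : ℕ × ℕ => Finsupp.single 0 ab.1 + Finsupp.single 1 ab.2)
    ((Finset.range N ×ˢ Finset.range N).finite_toSet)).subset ?_
  intro d hd
  simp only [Set.mem_setOf_eq] at hd
  refine ⟨(d 0, d 1), ?_, ?_⟩
  · simp only [Finset.coe_product, Finset.coe_range, Set.mem_prod, Set.mem_Iio]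
    constructor
    · have := le_wt_left d
      exact_mod_cast (show (d 0 : ℝ) < N by linarith)
    · have := le_wt_right d
      exact_mod_cast (show (d 1 : ℝ) < N by linarith)
  · ext i
    fin_cases i <;> simp

/-! ## The weight monomial order -/

/-- Type synonym of `Fin 2 →₀ ℕ` ordered by the weight `wt`. -/
def WtSyn : Type := Fin 2 →₀ ℕ

/-- the additive structure of the synonym [folklore] -/
instance : AddCommMonoid WtSyn := inferInstanceAs (AddCommMonoid (Fin 2 →₀ ℕ))

/-- the identification -/
def toWt : (Fin 2 →₀ ℕ) ≃+ WtSyn := AddEquiv.refl _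

/-- the weight, on the synonym -/
def WtSyn.w (a : WtSyn) : ℝ := wt (toWt.symm a)

/-- The weight is injective on the synonym. [folklore] -/
theorem WtSyn.w_injective : Function.Injective WtSyn.w := fun _ _ h => wt_injective h

/-- the synonym is linearly ordered by weight [folklore] -/
instance : LinearOrder WtSyn := LinearOrder.lift' WtSyn.w WtSyn.w_injective

/-- The order on the synonym is the order of weights. [folklore] -/
theorem WtSyn.le_iff {a b : WtSyn} : a ≤ b ↔ a.w ≤ b.w := Iff.rfl

/-- The strict order on the synonym is the strict order of weights. [folklore] -/
theorem WtSyn.lt_iff {a b : WtSyn} : a < b ↔ a.w < b.w := Iff.rfl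

/-- The weight on the synonym is additive. [folklore] -/
theorem WtSyn.w_add (a b : WtSyn) : (a + b).w = a.w + b.w := wt_add _ _

/-- the weight order is translation invariant [folklore] -/
instance : IsOrderedAddMonoid WtSyn where
  add_le_add_left a b h c := by
    rw [WtSyn.le_iff] at h ⊢
    rw [WtSyn.w_add, WtSyn.w_add]
    linarith

/-- the weight order is well founded: `a ↦ #{d : wt d < wt a}` is strictly monotone into `ℕ`
[folklore] -/
instance : WellFoundedLT WtSyn := by
  classical
  -- `a ↦ #{d : wt d < wt a}` is strictly monotone into `ℕ`
  let N : WtSyn → ℕ := fun a => (finite_wt_lt a.w).toFinset.card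
  have hN : StrictMono N := by
    intro a b hab
    apply Finset.card_lt_card
    rw [Finset.ssubset_iff_of_subset]
    · refine ⟨toWt.symm a, ?_, ?_⟩
      · simp only [Set.Finite.mem_toFinset, Set.mem_setOf_eq]
        exact hab
      · simp only [Set.Finite.mem_toFinset, Set.mem_setOf_eq]
        exact lt_irrefl _
    · intro d hd
      simp only [Set.Finite.mem_toFinset, Set.mem_setOf_eq] at hd ⊢
      exact hd.trans hab
  exact hN.wellFoundedLT

/-- The monomial order on `Fin 2` given by the irrational weight `(1, √2)`. -/
def wtOrder : MonomialOrder (Fin 2) where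
  syn := WtSyn
  toSyn := toWt
  toSyn_monotone := fun _ _ h => wt_mono h

/-- Comparison in the weight order is comparison of weights. [folklore] -/
theorem wtOrder_le_iff {d e : Fin 2 →₀ ℕ} : wtOrder.toSyn d ≤ wtOrder.toSyn e ↔ wt d ≤ wt e :=
  Iff.rfl

/-- Strict comparison in the weight order is strict comparison of weights. [folklore] -/
theorem wtOrder_lt_iff {d e : Fin 2 →₀ ℕ} : wtOrder.toSyn d < wtOrder.toSyn e ↔ wt d < wt e :=
  Iff.rfl

/-! ## The valuation on `k[x, y]` -/

variable (k : Type) [Field k]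

/-- `exp ∘ wt` as a nonnegative real -/
def expWt (d : Fin 2 →₀ ℕ) : NNReal := ⟨Real.exp (wt d), (Real.exp_pos _).le⟩

/-- `expWt` as a real number. [folklore] -/
@[simp] theorem coe_expWt (d : Fin 2 →₀ ℕ) : (expWt d : ℝ) = Real.exp (wt d) := rfl

/-- `expWt` is multiplicative. [folklore] -/
theorem expWt_add (d e : Fin 2 →₀ ℕ) : expWt (d + e) = expWt d * expWt e := by
  ext; simp [wt_add, Real.exp_add]

/-- `expWt 0 = 1`. [folklore] -/
@[simp] theorem expWt_zero : expWt 0 = 1 := by ext; simp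

/-- `expWt` is order-preserving. [folklore] -/
theorem expWt_le_iff {d e : Fin 2 →₀ ℕ} : expWt d ≤ expWt e ↔ wt d ≤ wt e := by
  rw [← NNReal.coe_le_coe, coe_expWt, coe_expWt, Real.exp_le_exp]

/-- `expWt` is strictly order-preserving. [folklore] -/
theorem expWt_lt_iff {d e : Fin 2 →₀ ℕ} : expWt d < expWt e ↔ wt d < wt e := by
  rw [← NNReal.coe_lt_coe, coe_expWt, coe_expWt, Real.exp_lt_exp]

/-- `expWt` is injective. [folklore] -/
theorem expWt_injective : Function.Injective expWt := by
  intro d e h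
  apply wt_injective
  have : (expWt d : ℝ) = expWt e := by rw [h]
  simpa using this

/-- `expWt` never vanishes. [folklore] -/
theorem expWt_ne_zero (d : Fin 2 →₀ ℕ) : expWt d ≠ 0 := by
  intro h
  have : (expWt d : ℝ) = 0 := by rw [h]; rfl
  simp at this

open Classical in
/-- the raw valuation map on polynomials -/
def v₀ (f : MvPolynomial (Fin 2) k) : NNReal := if f = 0 then 0 else expWt (wtOrder.degree f)

/-- The raw valuation of a nonzero polynomial. [folklore] -/
theorem v₀_of_ne_zero {f : MvPolynomial (Fin 2) k} (hf : f ≠ 0) :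
    v₀ k f = expWt (wtOrder.degree f) := by
  simp [v₀, hf]

/-- The raw valuation of `0`. [folklore] -/
@[simp] theorem v₀_zero : v₀ k 0 = 0 := by simp [v₀]

/-- The monomial valuation `x ↦ e`, `y ↦ e^{√2}` (at infinity) on `k[x,y]`, multiplicative into
`ℝ≥0`: `v f = exp (max weight of a monomial of f)`. -/
def wtValuation : Valuation (MvPolynomial (Fin 2) k) NNReal where
  toFun := v₀ k
  map_zero' := v₀_zero k
  map_one' := by
    rw [v₀_of_ne_zero k one_ne_zero, MonomialOrder.degree_one, expWt_zero]
  map_mul' f g := by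
    by_cases hf : f = 0
    · subst hf; simp
    by_cases hg : g = 0
    · subst hg; simp
    rw [v₀_of_ne_zero k hf, v₀_of_ne_zero k hg, v₀_of_ne_zero k (mul_ne_zero hf hg),
      MonomialOrder.degree_mul hf hg, expWt_add]
  map_add_le_max' f g := by
    by_cases hfg : f + g = 0
    · rw [hfg, v₀_zero]; exact zero_le
    by_cases hf : f = 0
    · subst hf; simp
    by_cases hg : g = 0
    · subst hg; simp
    rw [v₀_of_ne_zero k hf, v₀_of_ne_zero k hg, v₀_of_ne_zero k hfg]
    have h := (wtOrder).degree_add_le (f := f) (g := g)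
    rcases le_sup_iff.mp h with h | h
    · exact le_sup_of_le_left (expWt_le_iff.mpr (wtOrder_le_iff.mp h))
    · exact le_sup_of_le_right (expWt_le_iff.mpr (wtOrder_le_iff.mp h))

/-- Unfolding the valuation. [folklore] -/
theorem wtValuation_apply (f : MvPolynomial (Fin 2) k) : wtValuation k f = v₀ k f := rfl

/-- The valuation has trivial support. [folklore] -/
theorem wtValuation_eq_zero_iff {f : MvPolynomial (Fin 2) k} : wtValuation k f = 0 ↔ f = 0 := by
  rw [wtValuation_apply]
  by_cases h : f = 0
  · simp [h]
  · simp [v₀_of_ne_zero k h, h, expWt_ne_zero]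

/-- The value of a variable. [folklore] -/
theorem wtValuation_X (i : Fin 2) : wtValuation k (X i) = expWt (Finsupp.single i 1) := by
  rw [wtValuation_apply, v₀_of_ne_zero k (X_ne_zero i), MonomialOrder.degree_X]

/-- Nonzero constants have value `1`. [folklore] -/
theorem wtValuation_C {c : k} (hc : c ≠ 0) : wtValuation k (C c) = 1 := by
  rw [wtValuation_apply, v₀_of_ne_zero k (by simpa using hc), MonomialOrder.degree_C, expWt_zero]


/-! ## Cancellation of leading terms -/

/-- **Cancellation of leading terms**: if `a, b ≠ 0` have the same degree then
`a - (lc a / lc b) • b` has strictly smaller value than `a`. [folklore] -/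
theorem v_sub_smul_lt {a b : MvPolynomial (Fin 2) k} (ha : a ≠ 0) (hb : b ≠ 0)
    (hdeg : wtOrder.degree a = wtOrder.degree b) :
    wtValuation k (a - (wtOrder.leadingCoeff a / wtOrder.leadingCoeff b) • b) < wtValuation k a := by
  set c : k := wtOrder.leadingCoeff a / wtOrder.leadingCoeff b with hc
  have hlb : wtOrder.leadingCoeff b ≠ 0 := wtOrder.leadingCoeff_ne_zero_iff.mpr hb
  have hla : wtOrder.leadingCoeff a ≠ 0 := wtOrder.leadingCoeff_ne_zero_iff.mpr ha
  have hc0 : c ≠ 0 := div_ne_zero hla hlb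
  have hcb : c * wtOrder.leadingCoeff b = wtOrder.leadingCoeff a := by
    rw [hc, div_mul_cancel₀ _ hlb]
  -- degree and leading coefficient of `c • b`
  have hdeg_cb : wtOrder.degree (c • b) = wtOrder.degree b :=
    wtOrder.degree_smul_of_isRegular (IsRegular.of_ne_zero hc0)
  have hlc_cb : wtOrder.leadingCoeff (c • b) = wtOrder.leadingCoeff a := by
    rw [MonomialOrder.leadingCoeff, hdeg_cb, MvPolynomial.coeff_smul, smul_eq_mul,
      ← MonomialOrder.leadingCoeff, hcb]
  have hlt : wtOrder.leadingTerm (c • b) = wtOrder.leadingTerm a := by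
    rw [MonomialOrder.leadingTerm, MonomialOrder.leadingTerm, hdeg_cb, hlc_cb, hdeg]
  set h := a - c • b with hh
  have hsplit : h = (a - wtOrder.leadingTerm a) - (c • b - wtOrder.leadingTerm (c • b)) := by
    rw [hlt]; ring
  rw [wtValuation_apply, wtValuation_apply, v₀_of_ne_zero k ha]
  by_cases hzero : h = 0
  · rw [hzero, v₀_zero]
    exact pos_iff_ne_zero.mpr (expWt_ne_zero _)
  rw [v₀_of_ne_zero k hzero, expWt_lt_iff, ← wtOrder_lt_iff]
  by_cases hd : wtOrder.degree a = 0
  · -- constant case: then `h = 0`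
    exfalso
    apply hzero
    have ha' := wtOrder.eq_C_of_degree_eq_zero hd
    have hb' := wtOrder.eq_C_of_degree_eq_zero (hdeg ▸ hd : wtOrder.degree b = 0)
    rw [hh, ha', hb', MvPolynomial.smul_eq_C_mul, ← map_mul, ← map_sub, hcb, sub_self, map_zero]
  · have h1 := wtOrder.degree_sub_leadingTerm_lt_degree hd
    have h2 := wtOrder.degree_sub_leadingTerm_lt_degree (show wtOrder.degree (c • b) ≠ 0 by
      rwa [hdeg_cb, ← hdeg])
    rw [hdeg_cb, ← hdeg] at h2
    rw [hsplit]
    exact lt_of_le_of_lt wtOrder.degree_sub_le (sup_lt_iff.mpr ⟨h1, h2⟩)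

end MonomialValuation

end Summit.ResolutionOfSingularities.ResolutionOfSingularities.Theorems.RankOneTermination.Negative

end
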